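import Literature.Combinatorics.Additive.RelativeSzemerediProofs
import Literature.Combinatorics.Additive.RelativeSzemerediDenseModel
import Literature.Combinatorics.Additive.RelativeSzemerediCounting
import Literature.Combinatorics.Additive.SzemerediVarnavides
import HarnessLib

/-!
# Conlon–Fox–Zhao: the relative Szemerédi theorem length by length; the relative Roth theorem

Topic `Literature/Combinatorics/Additive`. Source: D. Conlon, J. Fox, Y. Zhao, *The Green–Tao
theorem: an exposition*, EMS Surv. Math. Sci. 1 (2014), 249–282 = arXiv:1403.2957 (held as
`paper:arxiv-1403.2957`; numbers are those of the arXiv version), Thm. 3.5 (relative Roth),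
Thm. 4.3 (relative Szemerédi) and its proof (§7).

State of the decomposition of the named fact `CFZ.RelativeSzemeredi` (Thm. 4.3, file
`RelativeSzemeredi.lean`). The tree proves §7 (`CFZ.relativeSzemeredi_of`: Thm. 4.3 from Thm. 4.1,
the dense model theorem `CFZ.DenseModel` and the counting lemma `CFZ.RelativeCounting`) and
discharges the last two (`CFZ.denseModel_holds`, `CFZ.relativeCounting_holds`); Thm. 4.1 for all
`k` is Szemerédi's theorem. This file runs the same proof ONE LENGTH `k` AT A TIME, so that what is
provable today is proved:

* `CFZ.RelativeSzemerediAt k` — Thm. 4.3 at length `k` (definitionally,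
  `CFZ.RelativeSzemeredi ↔ ∀ k ≥ 3, CFZ.RelativeSzemerediAt k`, `CFZ.relativeSzemeredi_iff`);
* `CFZ.relativeSzemerediAt_of_szemerediWeighted : 3 ≤ k → SzemerediWeighted k →
  CFZ.RelativeSzemerediAt k` — §7 at length `k`, PROVED (the proof of `CFZ.relativeSzemeredi_of`
  verbatim, fed with `denseModel_holds` and `relativeCounting_holds`);
* `CFZ.relativeRoth : CFZ.RelativeSzemerediAt 3` — **Thm. 3.5, the relative Roth theorem,
  unconditionally** (Mathlib's Roth theorem → Varnavides → Thm. 3.3 → §7);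
* `CFZ.relativeSzemeredi_of_szemerediFinitary : (∀ k ≥ 3, SzemerediFinitary k) →
  CFZ.RelativeSzemeredi` and `CFZ.szemerediExpectation_of_szemerediFinitary :
  (∀ k ≥ 3, SzemerediFinitary k) → GreenTao2008.SzemerediExpectation` — the two named facts of
  the Green–Tao assembly now rest on the finitary Szemerédi theorem alone
  (`Literature.Combinatorics.Additive.SzemerediFinitary k`, `k ≥ 4` open in Lean).

Faithfulness: Thm. 3.5 is printed for `ν : ℤ_N → [0,∞)` with `N` odd (footnote to Def. 3.4) and
the `3`-linear forms condition (3.3) = Def. 4.2 at `k = 3` (forms `2x+y`, `x-z`, `-y-2z`); as in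
`RelativeSzemeredi.lean`, `N → ∞` through primes, a special case of the printed range.

## References
* D. Conlon, J. Fox, Y. Zhao, *The Green–Tao theorem: an exposition*, EMS Surv. Math. Sci. 1
  (2014), 249–282, Thm. 3.5, Thm. 4.3, §7. [cite: ConlonFoxZhao2014]
* E. Szemerédi, Acta Arith. 27 (1975), 199–245. [cite: Szemeredi1975]
-/

noncomputable section

open Filter Finset
open scoped BigOperators

namespace Literature.Combinatorics.Additive.CFZ

/-- **Conlon–Fox–Zhao, Theorem 4.3 at a fixed length `k`.** For `0 < δ ≤ 1` there is `c > 0` such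
that for every nonnegative family `ν` satisfying the `k`-linear forms condition (Def. 4.2) and
every `f : ℤ_N → ℝ` with `0 ≤ f ≤ ν_N`, `𝔼 f ≥ δ`:
`𝔼_{x,d ∈ ℤ_N}[f(x) f(x+d) ⋯ f(x+(k-1)d)] ≥ c - o(1)`, `N → ∞` through primes, the rate depending
on `k, δ` and the rates in the linear forms condition. `CFZ.RelativeSzemeredi` is
`∀ k ≥ 3, RelativeSzemerediAt k`. [cite: ConlonFoxZhao2014, Theorem 4.3] -/
def RelativeSzemerediAt (k : ℕ) : Prop :=
  ∀ δ : ℝ, 0 < δ → δ ≤ 1 → ∃ c : ℝ, 0 < c ∧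
    ∀ ν : (N : ℕ) → ZMod N → ℝ, (∀ N x, 0 ≤ ν N x) → LinearFormsCondition k ν →
      ∀ η : ℝ, 0 < η → ∀ᶠ N : ℕ in atTop, ∀ [Fact N.Prime], ∀ f : ZMod N → ℝ,
        (∀ x, 0 ≤ f x) → (∀ x, f x ≤ ν N x) → δ ≤ 𝔼 x, f x →
          c - η ≤ 𝔼 x : ZMod N, 𝔼 d : ZMod N, ∏ i : Fin k, f (x + (i : ℕ) * d)

/-- `CFZ.RelativeSzemeredi` is the conjunction of its slices `k ≥ 3` (by `rfl`).
[cite: ConlonFoxZhao2014, Theorem 4.3] -/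
theorem relativeSzemeredi_iff : RelativeSzemeredi ↔ ∀ k : ℕ, 3 ≤ k → RelativeSzemerediAt k :=
  Iff.rfl

/-- Green–Tao's Prop. 2.3 (`GreenTao2008.SzemerediExpectation`, = CFZ Thm. 4.1 for all `k`) is the
conjunction of the slices `SzemerediWeighted k`, `k ≥ 1` (by `rfl`).
[cite: ConlonFoxZhao2014, Theorem 4.1] -/
theorem szemerediExpectation_iff :
    Literature.NumberTheory.Sieve.GreenTao2008.SzemerediExpectation ↔
      ∀ k : ℕ, 1 ≤ k → SzemerediWeighted k :=
  Iff.rfl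

/-- **§7 at a fixed length.** The relative Szemerédi theorem at length `k ≥ 3` follows from the
weighted Szemerédi theorem at the same length (Thm. 4.1 at `k`), the dense model theorem
(Thm. 5.1, `denseModel_holds`) and the relative counting lemma (Thm. 6.5,
`relativeCounting_holds`). The proof is that of `CFZ.relativeSzemeredi_of` (§7 of the source:
`‖ν - 1‖_{□,k-1} = o(1)` by Lemma 6.3; a dense model `f̃` with `‖f - f̃‖_{□,k-1} = o(1)`, whence
`𝔼 f̃ ≥ δ/2`; the counting lemma for `ν ∘ ψ_j, f ∘ ψ_j, f̃ ∘ ψ_j` after (7.1)–(7.2); and the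
reparametrisation `x = ψ_1(x_{-1})`, `d = ∑ x_i`), which uses Thm. 4.1 only at length `k` (at
density `δ/2`). [cite: ConlonFoxZhao2014, Section 7 (proof of Theorem 4.3)] -/
theorem relativeSzemerediAt_of_szemerediWeighted {k : ℕ} (hk : 3 ≤ k)
    (hSz : SzemerediWeighted k) : RelativeSzemerediAt k := by
  have hDM : DenseModel := denseModel_holds
  have hCL : RelativeCounting := relativeCounting_holds
  intro δ hδ hδ1
  obtain ⟨c, hc, hSz'⟩ := hSz (δ / 2) (by positivity) (by linarith)
  refine ⟨c, hc, fun ν hν hLFC η hη => ?_⟩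
  -- tolerances: counting lemma, dense model, linear forms
  obtain ⟨δ₁, hδ₁, hCL'⟩ := hCL k (η / 2) (by positivity)
  set j₀ : Fin k := ⟨0, by omega⟩ with hj₀
  obtain ⟨ε', hε', hDM'⟩ :=
    hDM (Fin k) (univ.erase j₀) (min δ₁ (δ / 2)) (lt_min hδ₁ (by positivity))
  set η₁ : ℝ := ε' ^ (2 ^ (k - 1)) / 2 ^ (2 ^ (k - 1)) with hη₁
  have hη₁pos : 0 < η₁ := by positivity
  have hη₀pos : 0 < min δ₁ η₁ := lt_min hδ₁ hη₁pos
  -- the three eventualities in `N`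
  filter_upwards [eventually_ge_atTop k, lfcWithin_of_linearFormsCondition hLFC hη₀pos,
    hSz' (η / 2) (by positivity)] with N hNk hL hS
  intro hprime f hf0 hfν hfδ
  haveI : NeZero N := ⟨hprime.out.ne_zero⟩
  have hL' : LFCWithin (fun (j : Fin k) (x : Fin k → ZMod N) => ν N (psi j x)) (min δ₁ η₁) := hL
  have hcard : Fintype.card (Fin k) = k := Fintype.card_fin k
  -- Step 1: `‖ν - 1‖_{□,k-1} ≤ ε'` (Lemma 6.3 / Gowers–Cauchy–Schwarz, then the scaling (7.1))
  have hν1 : HasSmallCut (univ.erase j₀) (fun x : Fin k → ZMod N => ν N (psi j₀ x) - 1) ε' := by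
    refine hasSmallCut_sub_one_of_lfcWithin (fun j x => ν N (psi j x)) j₀
      (hL'.mono (min_le_right _ _)) hε'.le ?_ ?_
    · rw [hcard]; omega
    · rw [hcard, hη₁, mul_div_cancel₀ _ (by positivity)]
  have hν1' : HasSmallCut (univ.erase j₀)
      (fun x : Fin k → ZMod N => ν N (∑ i ∈ univ.erase j₀, x i) - 1) ε' :=
    (hasSmallCut_psi_iff hNk j₀ (fun z => ν N z - 1) ε').mp hν1
  -- Step 2: the dense model `g = f̃`
  obtain ⟨g, hg0, hg1, hcut⟩ := hDM' N (ν N) (hν N) hν1' f hf0 hfν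
  -- Step 3: `𝔼 g ≥ δ/2`, and Szemerédi's theorem for `g`
  have hEg : δ / 2 ≤ 𝔼 x, g x := by
    have h1 := hcut.abs_expect_le
    have he : (univ.erase j₀ : Finset (Fin k)).Nonempty := by
      rw [← Finset.card_pos, Finset.card_erase_of_mem (mem_univ _), Finset.card_univ, hcard]
      omega
    rw [expect_comp_sum_eq he (fun z => f z - g z), Finset.expect_sub_distrib] at h1
    have h2 := (abs_le.mp (h1.trans (min_le_right _ _))).2
    linarith
  have hSg := hS g hg0 hg1 hEg
  -- Step 4: cut norms of `g_{-j} - g̃_{-j}` (relabelling and the scaling (7.2))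
  have hcutj : ∀ j : Fin k, HasSmallCut (univ.erase j)
      (fun x : Fin k → ZMod N => f (psi j x) - g (psi j x)) δ₁ := fun j =>
    (hasSmallCut_psi_iff hNk j (fun z => f z - g z) δ₁).mpr
      (hasSmallCut_sum_erase_of_sum_erase j₀ j (fun z => f z - g z) (hcut.mono (min_le_left _ _)))
  -- Step 5: the counting lemma for the hypergraph system `ν ∘ ψ_j, f ∘ ψ_j, g ∘ ψ_j`
  have hdep : ∀ (F : ZMod N → ℝ) (j : Fin k),
      DependsOn (fun x : Fin k → ZMod N => F (psi j x)) ({j}ᶜ : Set (Fin k)) :=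
    fun F j x y hxy => congrArg F (dependsOn_psi j hxy)
  have hcount := hCL' (ZMod N) (fun j x => ν N (psi j x)) (fun j x => f (psi j x))
    (fun j x => g (psi j x)) (hdep (ν N)) (hdep f) (hdep g) (fun j x => hf0 _) (fun j x => hfν _)
    (fun j x => hg0 _) (fun j x => hg1 _) (hL'.mono (min_le_left _ _)) hcutj
  -- Step 6: reparametrise both simplex counts as AP counts and conclude
  rw [Finset.expect_sub_distrib, expect_prod_psi_eq (by omega) f,
    expect_prod_psi_eq (by omega) g] at hcount
  have h3 := (abs_le.mp hcount).1
  linarith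

/-- **Conlon–Fox–Zhao, Theorem 3.5 (relative Roth theorem), unconditionally.** Let
`ν = (ν_N)`, `ν_N : ℤ_N → [0,∞)`, satisfy the `3`-linear forms condition (Def. 3.4 = Def. 4.2 at
`k = 3`: the forms `2x+y`, `x-z`, `-y-2z`). For every `0 < δ ≤ 1` there is `c = c(δ) > 0` such that
every `f : ℤ_N → [0,∞)` with `0 ≤ f ≤ ν` and `𝔼 f ≥ δ` satisfies
`𝔼_{x,d ∈ ℤ_N}[f(x) f(x+d) f(x+2d)] ≥ c - o_δ(1)` (`N → ∞` through primes; the rate depends also on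
the rates in the linear forms condition, Remark after Thm. 3.5). Proof: Mathlib's Roth theorem
(`roth_3ap_theorem_nat`) ⇒ Thm. 3.3 (`szemerediWeighted_three`, via Varnavides) ⇒ §7.
[cite: ConlonFoxZhao2014, Theorem 3.5] -/
theorem relativeRoth : RelativeSzemerediAt 3 :=
  relativeSzemerediAt_of_szemerediWeighted le_rfl szemerediWeighted_three

/-- **Thm. 4.3 at length `k` from the finitary Szemerédi theorem at length `k`** (Varnavides and
the passage to weights, `szemerediWeighted_of_finitary`, then §7).
[cite: ConlonFoxZhao2014, Theorem 4.3 (proof, §§5–7)] -/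
theorem relativeSzemerediAt_of_szemerediFinitary {k : ℕ} (hk : 3 ≤ k)
    (h : SzemerediFinitary k) : RelativeSzemerediAt k :=
  relativeSzemerediAt_of_szemerediWeighted hk (szemerediWeighted_of_finitary h)

/-- **The relative Szemerédi theorem from the finitary Szemerédi theorem.** `CFZ.RelativeSzemeredi`
(Thm. 4.3, all `k ≥ 3`) follows from Szemerédi's theorem in its finitary form at every length
`k ≥ 3` — the only input of the Conlon–Fox–Zhao proof not yet formalised (`k = 3` is
`szemerediFinitary_three`). [cite: ConlonFoxZhao2014, Theorem 4.3 (proof, §§5–7)] -/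
theorem relativeSzemeredi_of_szemerediFinitary
    (h : ∀ k : ℕ, 3 ≤ k → SzemerediFinitary k) : RelativeSzemeredi :=
  fun k hk => relativeSzemerediAt_of_szemerediFinitary hk (h k hk)

/-- **Green–Tao's Prop. 2.3 from the finitary Szemerédi theorem**: the named fact
`GreenTao2008.SzemerediExpectation` (= CFZ Thm. 4.1 for all `k ≥ 1`) follows from
`SzemerediFinitary k` for `k ≥ 3` (lengths `k ≤ 2` being trivial), by Varnavides' argument and
the passage to weights (`szemerediWeighted_of_finitary`). [cite: ConlonFoxZhao2014, Theorem 4.1] -/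
theorem szemerediExpectation_of_szemerediFinitary
    (h : ∀ k : ℕ, 3 ≤ k → SzemerediFinitary k) :
    Literature.NumberTheory.Sieve.GreenTao2008.SzemerediExpectation := by
  intro k _hk
  by_cases hk3 : 3 ≤ k
  · exact szemerediWeighted_of_finitary (h k hk3)
  · exact szemerediWeighted_of_le_two (by omega)

end Literature.Combinatorics.Additive.CFZ
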